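import Summits.SmoothPoincare4.SmoothPoincare4.Theorems.CylinderEntropyCylinderRungTwoKillingFluxDefs
import Summits.SmoothPoincare4.SmoothPoincare4.Theorems.CylinderEntropyCylinderRungTwoAreaDissipation
import Literature.Geometry.Riemannian.MCFComparisonPrinciple
import Literature.Geometry.Lorentzian.GreenIdentity
import HarnessLib

/-!
# Hamilton's monotonicity along a smooth cylinder flow, part 1: the transport formula
# `d/dt ∫_{Σ_t} f(t, ·) dμ_t = ∫_{Σ_t} (∂ₜf - H² f) dμ_t`

Part 1 of the proof of the registered stub `stub_hamiltonMonotonicity` of line `killing-flux` of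
the crux `CylinderEntropy.CylinderRungTwo` (stmt-SmoothPoincare4-7631): Hamilton's monotonicity of
the typed density along a smooth mean curvature flow `IsCylinderMCF M F ν T`
(`CylinderEntropyCylinderRungTwoKillingFluxDefs.lean`) of closed cross-sections of
`N = S⁴ × ℝ ⊂ ℝ⁶`. This file ports the measure-theoretic half of the tree's Huisken monotonicity
(`Literature/Geometry/Riemannian/MCFAreaEvolution.lean`, `IsClassicalMCF.hasDerivAt_integral_mul_density`,
dimension-locked to hypersurfaces of `ℝⁿ⁺¹`) to the codimension-two cylinder flow:

* `IsCylinderMCF.norm_deriv_sq_eq` — `‖∂ₜF‖² = H²` (`∂ₜF = -Hν`, `‖ν‖ = 1`);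
* `IsCylinderMCF.hasDerivAt_integral_mul_density` — **differentiation under the integral sign
  along the flow**: for `T ≤ a`, `t₀ ∈ (a, b)` and `f, ∂ₜf` jointly continuous on `(a, b) × M`,
  `d/dt|_{t₀} ∫_M f(t, w) θ_t(w) dμ_{t₀}(w) = ∫_M (∂ₜf(t₀, w) - H(t₀, w)² f(t₀, w)) dμ_{t₀}(w)`,
  where `μ_{t₀}` is the area measure of `g_{t₀} = F_{t₀}^*δ` and `θ_t = √D_t/√D_{t₀}` the ratio of
  the coordinate-frame Gram determinants (so that `θ_t dμ_{t₀} = dμ_t`,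
  `IsCylinderMCF.integral_riemannianMeasure_eq`); the pointwise input `∂ₜ√D_t = -H²√D_t` is the
  sibling file's `IsCylinderMCF.hasDerivAt_sqrt_det_gram_localFrame`;
* `IsCylinderMCF.integral_riemannianMeasure_eq` — `∫ φ dμ_t = ∫ θ_t φ dμ_{t₀}`;
* `stub_hamiltonMonotonicity_part1` — the registered sub-goal marker (the transport formula).

Everything is PROVED (no `sorry`, no new definitions, no named facts).

References: G. Huisken, J. Differential Geom. 20 (1984), §3; C. Mantegazza, *Lecture Notes on Mean
Curvature Flow* (2011), Prop. 2.3.3 and §3.2; R. S. Hamilton, *Monotonicity formulas for parabolic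
flows on manifolds*, Comm. Anal. Geom. 1 (1993) 127–137, §4.
-/

-- the prescribed namespace `Summit.SmoothPoincare4.SmoothPoincare4.…` repeats `SmoothPoincare4`
set_option linter.dupNamespace false

noncomputable section

open Bundle MeasureTheory Set Function Filter Module
open scoped Manifold ContDiff ENNReal Topology RealInnerProductSpace NNReal Matrix

namespace Summit.SmoothPoincare4.SmoothPoincare4.Cruxes.CylinderRungTwo.KillingFlux

open Literature.Geometry.Riemannian Literature.Geometry.Riemannian.EuclideanHypersurface
open Literature.Geometry.Lorentzian Literature.Geometry.Lorentzian.PseudoRiemannianMetric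
open Literature.Analysis.Calculus

section Transport

variable {M : Type} [TopologicalSpace M] [ChartedSpace (EuclideanSpace ℝ (Fin 4)) M]
  [IsManifold (𝓡 4) ∞ M] {F ν : ℝ → M → EuclideanSpace ℝ (Fin 6)} {T : ℝ}

/-- `‖∂ₜF‖² = H²` along a cylinder flow (`∂ₜF = -Hν`, `‖ν‖ = 1`); in particular `H²` is jointly
continuous in `(t, y)`. [folklore] -/
theorem IsCylinderMCF.norm_deriv_sq_eq (h : IsCylinderMCF M F ν T) {t : ℝ} (ht : T ≤ t) (y : M) :
    ‖deriv (fun s => F s y) t‖ ^ 2 =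
      ((euclideanMetric (EuclideanSpace ℝ (Fin 6))).meanCurvature (F t)
        contMDiff_pullbackBilin_holds (h.isSpacelikeImmersion t ht) (ν t) y) ^ 2 := by
  set w : EuclideanSpace ℝ (Fin 6) := ν t y with hw
  set H₁ : ℝ := (euclideanMetric (EuclideanSpace ℝ (Fin 6))).meanCurvature (F t)
    contMDiff_pullbackBilin_holds (h.isSpacelikeImmersion t ht) (ν t) y with hH₁
  have hv : deriv (fun s => F s y) t = (-H₁) • w := h.deriv_slice_eq ht y
  have hν : ⟪w, w⟫ = (1 : ℝ) := by
    have := (h.isUnitNormal t ht).val_self y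
    rwa [euclideanMetric_apply] at this
  rw [hv, norm_smul, mul_pow, ← real_inner_self_eq_norm_sq w, hν, Real.norm_eq_abs, sq_abs, mul_one,
    neg_sq]

variable [T2Space M] [CompactSpace M] [MeasurableSpace M] [BorelSpace M]

/-- **Differentiation of `∫ f(t, ·) dμ_t` along a cylinder flow** (the measure written against the
fixed measure `μ_{t₀}` with the density `θ_t = √D_t/√D_{t₀}`): for `T ≤ a`, `t₀ ∈ (a, b)` and
`f, ∂ₜf` jointly continuous on `(a, b) × M`,

  `d/dt|_{t₀} ∫_M f(t, w) θ_t(w) dμ_{t₀}(w) = ∫_M (∂ₜf(t₀, w) - H(t₀, w)² f(t₀, w)) dμ_{t₀}(w)`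

(`∂ₜθ_t = -H²θ_t`, `θ_{t₀} = 1`; differentiation under the integral sign, the derivative being
bounded on a compact time slab: `θ_t` is non-increasing in `t`, `H² = ‖∂ₜF‖²` is jointly
continuous). Port of the tree's `IsClassicalMCF.hasDerivAt_integral_mul_density` to the
codimension-two flow in `N ⊂ ℝ⁶`. [cite: Mantegazza2011, Prop. 2.3.3] [cite: Huisken1984, §3] -/
theorem IsCylinderMCF.hasDerivAt_integral_mul_density (h : IsCylinderMCF M F ν T) {a b t₀ : ℝ}
    (ha : T ≤ a) (ht₀ : t₀ ∈ Ioo a b) {f f' : ℝ → M → ℝ}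
    (hfc : ContinuousOn (uncurry f) (Ioo a b ×ˢ univ))
    (hf'c : ContinuousOn (uncurry f') (Ioo a b ×ˢ univ))
    (hfd : ∀ t ∈ Ioo a b, ∀ w, HasDerivAt (fun s => f s w) (f' t w) t) :
    HasDerivAt (fun t => ∫ w, f t w *
        (Real.sqrt (Matrix.of fun i j =>
          (euclideanMetric (EuclideanSpace ℝ (Fin 6))).inducedBilin (𝓡 4) (F t) w
            ((trivializationAt (EuclideanSpace ℝ (Fin 4)) (TangentSpace (𝓡 4)) w).localFrame
              (EuclideanSpace.basisFun (Fin 4) ℝ).toBasis i w)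
            ((trivializationAt (EuclideanSpace ℝ (Fin 4)) (TangentSpace (𝓡 4)) w).localFrame
              (EuclideanSpace.basisFun (Fin 4) ℝ).toBasis j w)).det /
         Real.sqrt (Matrix.of fun i j =>
          (euclideanMetric (EuclideanSpace ℝ (Fin 6))).inducedBilin (𝓡 4) (F t₀) w
            ((trivializationAt (EuclideanSpace ℝ (Fin 4)) (TangentSpace (𝓡 4)) w).localFrame
              (EuclideanSpace.basisFun (Fin 4) ℝ).toBasis i w)
            ((trivializationAt (EuclideanSpace ℝ (Fin 4)) (TangentSpace (𝓡 4)) w).localFrame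
              (EuclideanSpace.basisFun (Fin 4) ℝ).toBasis j w)).det)
        ∂riemannianMeasure ((euclideanMetric (EuclideanSpace ℝ (Fin 6))).inducedRiemannianMetric
          (F t₀) contMDiff_pullbackBilin_holds (h.isSpacelikeImmersion t₀ (ha.trans ht₀.1.le))))
      (∫ w, (f' t₀ w - ((euclideanMetric (EuclideanSpace ℝ (Fin 6))).meanCurvature (F t₀)
          contMDiff_pullbackBilin_holds (h.isSpacelikeImmersion t₀ (ha.trans ht₀.1.le)) (ν t₀) w) ^ 2 *
            f t₀ w)
        ∂riemannianMeasure ((euclideanMetric (EuclideanSpace ℝ (Fin 6))).inducedRiemannianMetric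
          (F t₀) contMDiff_pullbackBilin_holds (h.isSpacelikeImmersion t₀ (ha.trans ht₀.1.le))))
      t₀ := by
  obtain ⟨U, hU, hIU, hF⟩ := h.contMDiffOn
  have hIab : ∀ {t}, t ∈ Icc a b → T ≤ t := fun ht => ha.trans ht.1
  have ht₀' : t₀ ∈ Icc a b := Ioo_subset_Icc_self ht₀
  -- notation: the metrics, the reference measure, the densities
  set g : ∀ t, T ≤ t → ContMDiffRiemannianMetric (𝓡 4) ∞ (EuclideanSpace ℝ (Fin 4))
      (TangentSpace (𝓡 4) : M → Type _) := fun t ht =>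
    (euclideanMetric (EuclideanSpace ℝ (Fin 6))).inducedRiemannianMetric (F t)
      contMDiff_pullbackBilin_holds (h.isSpacelikeImmersion t ht) with hg
  set μ₀ := riemannianMeasure (g t₀ (hIab ht₀')) with hμ₀
  haveI : IsFiniteMeasure μ₀ := isFiniteMeasure_riemannianMeasure _
  set D : ℝ → M → ℝ := fun t w => (Matrix.of fun i j =>
    (euclideanMetric (EuclideanSpace ℝ (Fin 6))).inducedBilin (𝓡 4) (F t) w
      ((trivializationAt (EuclideanSpace ℝ (Fin 4)) (TangentSpace (𝓡 4)) w).localFrame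
        (EuclideanSpace.basisFun (Fin 4) ℝ).toBasis i w)
      ((trivializationAt (EuclideanSpace ℝ (Fin 4)) (TangentSpace (𝓡 4)) w).localFrame
        (EuclideanSpace.basisFun (Fin 4) ℝ).toBasis j w)).det with hD
  set θ : ℝ → M → ℝ := fun t w => Real.sqrt (D t w) / Real.sqrt (D t₀ w) with hθ
  set Hm : ∀ t, T ≤ t → M → ℝ := fun t ht w => (euclideanMetric (EuclideanSpace ℝ (Fin 6))).meanCurvature
    (F t) contMDiff_pullbackBilin_holds (h.isSpacelikeImmersion t ht) (ν t) w with hHm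
  set Hsq : ℝ → M → ℝ := fun t w => ‖deriv (fun s => F s w) t‖ ^ 2 with hHsq
  -- (1) the densities: chart identification, positivity, continuity, derivative
  have hDchart : ∀ t (ht : T ≤ t) w,
      chartGramMatrix (g t ht) w (extChartAt (𝓡 4) w w) = Matrix.of fun i j =>
        (euclideanMetric (EuclideanSpace ℝ (Fin 6))).inducedBilin (𝓡 4) (F t) w
          ((trivializationAt (EuclideanSpace ℝ (Fin 4)) (TangentSpace (𝓡 4)) w).localFrame
            (EuclideanSpace.basisFun (Fin 4) ℝ).toBasis i w)
          ((trivializationAt (EuclideanSpace ℝ (Fin 4)) (TangentSpace (𝓡 4)) w).localFrame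
            (EuclideanSpace.basisFun (Fin 4) ℝ).toBasis j w) :=
    fun t ht w => chartGramMatrix_inducedRiemannianMetric_self_of_immersion (h.isSpacelikeImmersion t ht) w
  have hDpos : ∀ t (ht : T ≤ t) w, 0 < Real.sqrt (D t w) := fun t ht w => by
    have := sqrt_det_chartGramMatrix_pos (g t ht) w (mem_extChartAt_target w)
    rwa [hDchart t ht w] at this
  have hθcan : ∀ t (ht : T ≤ t), θ t = fun w =>
      Real.sqrt (chartGramMatrix (g t ht) w (extChartAt (𝓡 4) w w)).det /
        Real.sqrt (chartGramMatrix (g t₀ (hIab ht₀')) w (extChartAt (𝓡 4) w w)).det := fun t ht => by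
    funext w
    simp only [hθ, hD, hDchart t ht w, hDchart t₀ (hIab ht₀') w]
  have hθcont : ∀ t (ht : T ≤ t), Continuous (θ t) := fun t ht => by
    rw [hθcan t ht]
    exact continuous_sqrt_det_chartGramMatrix_div (g t ht) (g t₀ (hIab ht₀'))
  have hθpos : ∀ t (ht : T ≤ t) w, 0 < θ t w := fun t ht w =>
    div_pos (hDpos t ht w) (hDpos t₀ (hIab ht₀') w)
  have hθ₀ : ∀ w, θ t₀ w = 1 := fun w => div_self (hDpos t₀ (hIab ht₀') w).ne'
  have hθd : ∀ t (ht : T ≤ t) w, HasDerivAt (fun s => θ s w) (-(Hm t ht w) ^ 2 * θ t w) t :=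
    fun t ht w => by
    have hd := (h.hasDerivAt_sqrt_det_gram_localFrame ht w).div_const (Real.sqrt (D t₀ w))
    simp only [hθ]
    refine hd.congr_deriv ?_
    simp only [hHm, hD]
    ring
  -- (2) `H² = ‖∂ₜF‖²` is jointly continuous
  have hHsq : ∀ t (ht : T ≤ t) w, Hsq t w = Hm t ht w ^ 2 := fun t ht w => h.norm_deriv_sq_eq ht w
  have hHsqc : ContinuousOn (uncurry Hsq) (U ×ˢ univ) :=
    ((continuousOn_timeDeriv hU hF).norm).pow 2
  have hHsq0 : ∀ t w, 0 ≤ Hsq t w := fun t w => by positivity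
  clear_value Hsq θ D
  -- (3) a compact time slab around `t₀`
  obtain ⟨δ, hδ, hslab⟩ : ∃ δ > 0, Icc (t₀ - δ) (t₀ + δ) ⊆ Ioo a b := by
    refine ⟨min (t₀ - a) (b - t₀) / 2, by
      have := ht₀.1; have := ht₀.2; positivity, fun t ht => ⟨?_, ?_⟩⟩
    · have h1 : min (t₀ - a) (b - t₀) ≤ t₀ - a := min_le_left _ _
      linarith [ht.1, ht₀.1, ht₀.2]
    · have h2 : min (t₀ - a) (b - t₀) ≤ b - t₀ := min_le_right _ _
      linarith [ht.2, ht₀.1, ht₀.2]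
  have hslab' : Icc (t₀ - δ) (t₀ + δ) ⊆ Icc a b := hslab.trans Ioo_subset_Icc_self
  have hIU' : Icc a b ⊆ U := fun t ht => hIU (mem_Ici.2 (hIab ht))
  have hK : IsCompact (Icc (t₀ - δ) (t₀ + δ) ×ˢ (univ : Set M)) := isCompact_Icc.prod isCompact_univ
  -- bounds: `|f'| ≤ C₁`, `|f| ≤ C₀`, `H² ≤ C₂` on the slab, `θ ≤ M`
  obtain ⟨C₀, hC₀⟩ := hK.exists_bound_of_continuousOn (hfc.mono (Set.prod_mono hslab subset_rfl))
  obtain ⟨C₁, hC₁⟩ := hK.exists_bound_of_continuousOn (hf'c.mono (Set.prod_mono hslab subset_rfl))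
  obtain ⟨C₂, hC₂⟩ := hK.exists_bound_of_continuousOn
    (hHsqc.mono (Set.prod_mono (hslab'.trans hIU') subset_rfl))
  have htδ : t₀ - δ ∈ Icc a b := hslab' ⟨le_rfl, by linarith⟩
  obtain ⟨Mb, hM⟩ := (isCompact_univ (X := M)).exists_bound_of_continuousOn
    (hθcont (t₀ - δ) (hIab htδ)).continuousOn
  -- `θ` is non-increasing in `t` on `[a, b]`
  have hθd' : ∀ t (ht : t ∈ Icc a b) w, HasDerivAt (fun s => θ s w) (-(Hsq t w) * θ t w) t :=
    fun t ht w => (hθd t (hIab ht) w).congr_deriv (by rw [hHsq t (hIab ht) w])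
  have hθanti : ∀ w, AntitoneOn (fun s => θ s w) (Icc a b) := fun w => by
    refine antitoneOn_of_hasDerivWithinAt_nonpos (convex_Icc a b) (f' := fun t => -(Hsq t w) * θ t w)
      (fun t ht => (hθd t (hIab ht) w).continuousAt.continuousWithinAt)
      (fun t ht => (hθd' t (interior_subset ht) w).hasDerivWithinAt) fun t ht => ?_
    have h1 := hθpos t (hIab (interior_subset ht)) w
    have h2 : 0 ≤ Hsq t w := hHsq0 t w
    nlinarith
  have hθle : ∀ t ∈ Icc (t₀ - δ) (t₀ + δ), ∀ w, θ t w ≤ Mb := fun t ht w => by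
    have h1 : θ t w ≤ θ (t₀ - δ) w := hθanti w htδ (hslab' ht) ht.1
    have h2 : θ (t₀ - δ) w ≤ Mb := by
      have := hM w (mem_univ w)
      rw [Real.norm_eq_abs] at this
      exact (le_abs_self _).trans this
    exact h1.trans h2
  -- (4) differentiation under the integral sign
  have hcontt : ∀ t ∈ Ioo a b, Continuous (f t) := fun t ht =>
    hfc.comp_continuous (continuous_const.prodMk continuous_id) fun y => ⟨ht, mem_univ _⟩
  have hcontt' : ∀ t ∈ Ioo a b, Continuous (f' t) := fun t ht =>
    hf'c.comp_continuous (continuous_const.prodMk continuous_id) fun y => ⟨ht, mem_univ _⟩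
  have hHsqt : ∀ t ∈ Icc a b, Continuous (Hsq t) := fun t ht =>
    hHsqc.comp_continuous (continuous_const.prodMk continuous_id) fun y => ⟨hIU' ht, mem_univ _⟩
  set C : ℝ := C₁ * Mb + C₀ * (C₂ * Mb) with hC
  have hΦ := hasDerivAt_integral_of_dominated_loc_of_deriv_le (μ := μ₀)
    (F := fun t w => f t w * θ t w)
    (F' := fun t w => f' t w * θ t w + f t w * (-(Hsq t w) * θ t w))
    (x₀ := t₀) (s := Ioo (t₀ - δ) (t₀ + δ)) (bound := fun _ => C)
    (Ioo_mem_nhds (by linarith) (by linarith))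
    (by
      filter_upwards [isOpen_Ioo.mem_nhds ht₀] with t ht
      exact ((hcontt t ht).mul (hθcont t (hIab (Ioo_subset_Icc_self ht)))).aestronglyMeasurable)
    (integrable_of_continuous (h := g t₀ (hIab ht₀')) ((hcontt t₀ ht₀).mul (hθcont t₀ (hIab ht₀'))))
    ((((hcontt' t₀ ht₀).mul (hθcont t₀ (hIab ht₀'))).add ((hcontt t₀ ht₀).mul
      (((hHsqt t₀ ht₀').neg).mul (hθcont t₀ (hIab ht₀'))))).aestronglyMeasurable)
    (Eventually.of_forall fun w t ht => by
      have ht' : t ∈ Icc (t₀ - δ) (t₀ + δ) := Ioo_subset_Icc_self ht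
      have h0 := hC₀ (t, w) ⟨ht', mem_univ _⟩
      have h1 := hC₁ (t, w) ⟨ht', mem_univ _⟩
      have h2 := hC₂ (t, w) ⟨ht', mem_univ _⟩
      simp only [uncurry_apply_pair, Real.norm_eq_abs] at h0 h1 h2
      have hθw := hθle t ht' w
      have hθ0 := (hθpos t (hIab (hslab' ht')) w).le
      have hH0 : 0 ≤ Hsq t w := hHsq0 t w
      have hC2' : Hsq t w ≤ C₂ := (le_abs_self _).trans h2
      have hC₁0 : 0 ≤ C₁ := (abs_nonneg _).trans h1
      have hC₀0 : 0 ≤ C₀ := (abs_nonneg _).trans h0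
      have hC₂0 : 0 ≤ C₂ := hH0.trans hC2'
      rw [Real.norm_eq_abs]
      calc |f' t w * θ t w + f t w * (-(Hsq t w) * θ t w)|
          ≤ |f' t w * θ t w| + |f t w * (-(Hsq t w) * θ t w)| := abs_add_le _ _
        _ = |f' t w| * θ t w + |f t w| * (Hsq t w * θ t w) := by
            rw [abs_mul, abs_mul, abs_of_nonneg hθ0, neg_mul, abs_neg,
              abs_of_nonneg (mul_nonneg hH0 hθ0)]
        _ ≤ C₁ * Mb + C₀ * (C₂ * Mb) :=
            add_le_add (mul_le_mul h1 hθw hθ0 hC₁0)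
              (mul_le_mul h0 (mul_le_mul hC2' hθw hθ0 hC₂0) (mul_nonneg hH0 hθ0) hC₀0))
    (integrable_const C)
    (Eventually.of_forall fun w t ht => by
      have ht' : t ∈ Icc a b := hslab' (Ioo_subset_Icc_self ht)
      have hprod := (hfd t (hslab (Ioo_subset_Icc_self ht)) w).mul (hθd t (hIab ht') w)
      refine hprod.congr_deriv ?_
      rw [hHsq t (hIab ht') w])
  obtain ⟨-, hΦ2⟩ := hΦ
  have key : HasDerivAt (fun t => ∫ w, f t w * θ t w ∂μ₀)
      (∫ w, (f' t₀ w - Hm t₀ (hIab ht₀') w ^ 2 * f t₀ w) ∂μ₀) t₀ := by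
    refine hΦ2.congr_deriv ?_
    refine integral_congr_ae (Eventually.of_forall fun w => ?_)
    simp only [hθ₀ w, hHsq t₀ (hIab ht₀') w]
    ring
  simp only [hθ, hD] at key
  exact key

/-- **`∫ φ dμ_t = ∫ θ_t φ dμ_{t₀}`** along a cylinder flow: integration against the area measure
of `g_t = F_t^*δ` is integration of `θ_t φ` against that of `g_{t₀}`, `θ_t = √D_t/√D_{t₀}` the
coordinate-frame density ratio (tree `integral_riemannianMeasure_eq_integral_mul`).
[cite: Mantegazza2011, Prop. 2.3.3] -/
theorem IsCylinderMCF.integral_riemannianMeasure_eq (h : IsCylinderMCF M F ν T) {t t₀ : ℝ}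
    (ht : T ≤ t) (ht₀ : T ≤ t₀) {E : Type*} [NormedAddCommGroup E] [NormedSpace ℝ E]
    (φ : M → E) :
    ∫ w, φ w ∂riemannianMeasure ((euclideanMetric (EuclideanSpace ℝ (Fin 6))).inducedRiemannianMetric
        (F t) contMDiff_pullbackBilin_holds (h.isSpacelikeImmersion t ht)) =
      ∫ w, (Real.sqrt (Matrix.of fun i j =>
          (euclideanMetric (EuclideanSpace ℝ (Fin 6))).inducedBilin (𝓡 4) (F t) w
            ((trivializationAt (EuclideanSpace ℝ (Fin 4)) (TangentSpace (𝓡 4)) w).localFrame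
              (EuclideanSpace.basisFun (Fin 4) ℝ).toBasis i w)
            ((trivializationAt (EuclideanSpace ℝ (Fin 4)) (TangentSpace (𝓡 4)) w).localFrame
              (EuclideanSpace.basisFun (Fin 4) ℝ).toBasis j w)).det /
         Real.sqrt (Matrix.of fun i j =>
          (euclideanMetric (EuclideanSpace ℝ (Fin 6))).inducedBilin (𝓡 4) (F t₀) w
            ((trivializationAt (EuclideanSpace ℝ (Fin 4)) (TangentSpace (𝓡 4)) w).localFrame
              (EuclideanSpace.basisFun (Fin 4) ℝ).toBasis i w)
            ((trivializationAt (EuclideanSpace ℝ (Fin 4)) (TangentSpace (𝓡 4)) w).localFrame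
              (EuclideanSpace.basisFun (Fin 4) ℝ).toBasis j w)).det) • φ w
        ∂riemannianMeasure ((euclideanMetric (EuclideanSpace ℝ (Fin 6))).inducedRiemannianMetric
          (F t₀) contMDiff_pullbackBilin_holds (h.isSpacelikeImmersion t₀ ht₀)) := by
  rw [integral_riemannianMeasure_eq_integral_mul]
  refine integral_congr_ae (Eventually.of_forall fun w => ?_)
  simp only [chartGramMatrix_inducedRiemannianMetric_self_of_immersion]

end Transport

/-- **Registered sub-goal marker `stub_hamiltonMonotonicity_part1` (the transport formula along a
smooth cylinder flow).** For `IsCylinderMCF M F ν T`, `T ≤ a`, `t₀ ∈ (a, b)` and `f, ∂ₜf` jointly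
continuous on `(a, b) × M` with `∂ₜf` the time derivative of `f`:
`d/dt|_{t₀} ∫_M f(t, w) θ_t(w) dμ_{t₀}(w) = ∫_M (∂ₜf(t₀, w) - H(t₀, w)² f(t₀, w)) dμ_{t₀}(w)`
(`IsCylinderMCF.hasDerivAt_integral_mul_density`). [cite: Mantegazza2011, Prop. 2.3.3] [cite: Huisken1984, §3] -/
theorem stub_hamiltonMonotonicity_part1 :
    ∀ (M : Type) [TopologicalSpace M] [T2Space M] [ChartedSpace (EuclideanSpace ℝ (Fin 4)) M] [IsManifold (𝓡 4) ∞ M] [CompactSpace M] [MeasurableSpace M] [BorelSpace M] (F : ℝ → M → EuclideanSpace ℝ (Fin 6)) (ν : ℝ → M → EuclideanSpace ℝ (Fin 6)) (T : ℝ) (h : IsCylinderMCF M F ν T) (a b t₀ : ℝ) (ha : T ≤ a) (ht₀ : t₀ ∈ Set.Ioo a b) (f f' : ℝ → M → ℝ), ContinuousOn (Function.uncurry f) (Set.Ioo a b ×ˢ Set.univ) → ContinuousOn (Function.uncurry f') (Set.Ioo a b ×ˢ Set.univ) → (∀ t ∈ Set.Ioo a b, ∀ w, HasDerivAt (fun s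 => f s w) (f' t w) t) → HasDerivAt (fun t => ∫ w, f t w * (Real.sqrt (Matrix.of fun i j => (Literature.Geometry.Riemannian.euclideanMetric (EuclideanSpace ℝ (Fin 6))).inducedBilin (𝓡 4) (F t) w ((trivializationAt (EuclideanSpace ℝ (Fin 4)) (TangentSpace (𝓡 4)) w).localFrame (EuclideanSpace.basisFun (Fin 4) ℝ).toBasis i w) ((trivializationAt (EuclideanSpace ℝ (Fin 4)) (TangentSpace (𝓡 4)) w).localFrame (EuclideanSpace.basisFun (Fin 4) ℝ).toBasis j w)).det / Real.sqrt (Matrix.of fun i j => (Literature.Geometry.Riemannian.euclideanMetric (EuclideanSpace ℝ (Fin 6))).inducedBilin (𝓡 4) (F t₀) w ((trivializationAt (EuclideanSpace ℝ (Fin 4)) (TangentSpace (𝓡 4)) w).localFrame (EuclideanSpace.basisFun (Fin 4) ℝ).toBasis i w) ((trivializationAt (EuclideanSpace ℝ (Fin 4)) (TangentSpace (𝓡 4)) w).localFrame (EuclideanSpace.basisFun (Fin 4) ℝ).toBasis j w)).det) ∂Literature.Geometry.Lorentzian.riemannianMeasure ((Literature.Geometry.Riemannian.euclideanMetric (EuclideanSpace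 ℝ (Fin 6))).inducedRiemannianMetric (F t₀) Literature.Geometry.Lorentzian.PseudoRiemannianMetric.contMDiff_pullbackBilin_holds (h.isSpacelikeImmersion t₀ (ha.trans ht₀.1.le)))) (∫ w, (f' t₀ w - ((Literature.Geometry.Riemannian.euclideanMetric (EuclideanSpace ℝ (Fin 6))).meanCurvature (F t₀) Literature.Geometry.Lorentzian.PseudoRiemannianMetric.contMDiff_pullbackBilin_holds (h.isSpacelikeImmersion t₀ (ha.trans ht₀.1.le)) (ν t₀) w) ^ 2 * f t₀ w) ∂Literature.Geometry.Lorentzian.riemannianMeasure ((Literature.Geometry.Riemannian.euclideanMetric (EuclideanSpace ℝ (Fin 6))).inducedRiemannianMetric (F t₀) Literature.Geometry.Lorentzian.PseudoRiemannianMetric.contMDiff_pullbackBilin_holds (h.isSpacelikeImmersion t₀ (ha.trans ht₀.1.le)))) t₀ :=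
  fun _ _ _ _ _ _ _ _ _ _ _ h _ _ _ ha ht₀ _ _ hfc hf'c hfd =>
    h.hasDerivAt_integral_mul_density ha ht₀ hfc hf'c hfd


end Summit.SmoothPoincare4.SmoothPoincare4.Cruxes.CylinderRungTwo.KillingFlux

end
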